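import Mathlib
import Literature.NumberTheory.LFunctions.Zhang2022.Section15I2plusShift
import Literature.NumberTheory.LFunctions.Zhang2022.TypedSection15ASubsteps
import HarnessLib

/-!
# Zhang (2022) §15 (15.5), p. 81 — the typed first half `Eq15_5a` (the move `𝔍(α) → 𝔍(1)`) HOLDS

Topic `Literature/NumberTheory/LFunctions/Zhang2022` (Landau–Siegel audit tree; verdict-neutral).
Y. Zhang, *Discrete mean estimates and the Landau–Siegel zero*, arXiv:2211.02515v1 (2022)
[Zhang2022LandauSiegel] — **an unrefereed manuscript under adjudication; nothing here asserts or
denies its Theorems 1–2.** ZHANG-L discharge lane (WP15, leaf `Typed.Section15A.Eq15_6`); THEOREM-ONLY.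

The typer's sub-step file `TypedSection15ASubsteps` splits (15.5) ("moving the segment `𝔍(α)` to
`𝔍(1)` with a negligible error, we obtain `Σ_{ψ∈Ψ₁} I₂⁺(ψ) = Θ₂(0,𝐤₁*,𝐚₁*) + O(ε)`", §15 p. 81,
tex L4081) into the move `Eq15_5a c′` and the exact identification `Eq15_5b c′ b`. The identification
at the χ-reading is the tree identity `sum_I2pm_one_eq_Theta2` (`eq15_5b_chi_holds`), and the whole
(15.5) at the χ-reading is the tree theorem `eq15_5_chi_holds` (`Section15I2plusShift`, from
Proposition 2.2 (i)); hence the move `Eq15_5a c′` — whose statement does not mention `b` — holds: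
rewrite `Σ_{ψ∈Ψ₁} I₂(ψ;𝔍(1))` as `Θ₂(0,κ₁∗(χb),g̃₃)` and apply (15.5). This file records it BY NAME
(`eq15_5a_holds`), discharging that CLAIM node.

## References

* Y. Zhang, arXiv:2211.02515v1 (2022), §15 (15.5) p. 81, tex L4081. [cite: Zhang2022LandauSiegel, §15 (15.5) p. 81]
-/

noncomputable section

namespace Literature.NumberTheory.LFunctions.Zhang2022.Typed.Section15A

/-- **`Z22:(15.5)`, first half, DISCHARGED** (`Eq15_5a c′`: under (A),
`‖Σ_{ψ∈Ψ₁} I₂(ψ;𝔍(α)) − Σ_{ψ∈Ψ₁} I₂(ψ;𝔍(1))‖ ≤ C·e^{−c𝓛¹⁰}` for all large `D`) — from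
`eq15_5_chi_holds` and the exact identity `sum_I2pm_one_eq_Theta2`.
[cite: Zhang2022LandauSiegel, §15 (15.5) p. 81, tex L4081] -/
theorem eq15_5a_holds (c' : ℝ) : Eq15_5a c' := by
  obtain ⟨c, hc, C, D₀, h⟩ := eq15_5_chi_holds c'
  refine ⟨c, hc, C, D₀, fun D _ χ hD hq hp hA => ?_⟩
  rw [sum_I2pm_one_eq_Theta2 c' χ]
  exact h D χ hD hq hp hA

end Literature.NumberTheory.LFunctions.Zhang2022.Typed.Section15A
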